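import Literature.Barriers.QuantumAdvantage.TQBFCarry
import Literature.Barriers.QuantumAdvantage.TQBFCodewords
import Literature.Computability.Complexity.OrbitDeciders
import Literature.Computability.Complexity.FoldBricks
import HarnessLib

/-!
# `TQBF ∈ PSPACE`, III: the orbit decider (Arora–Barak 2009, Thm. 4.13, first half)

Assembly of parts I (`TQBFCarry.lean`: the evaluation state `blocks L`, the carry transducer
`carryT`, the `2^m`-round induction `iterate_mround_final`) and II (`TQBFCodewords.lean`: the
validity test `validFn`) into an ORBIT DECIDER for the tree's `TQBF` (`OrbitDeciders.lean`:
an `FP` round function, an `FP` initial state, an `FP` unary budget, polynomially short orbit,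
answer in the head bit after exactly `2^{budget}` rounds), whence **`TQBF_mem_PSPACE : TQBF ∈ PSPACE`**
by `OrbitDecider.mem_PSPACE` (the loop space machine of `SpaceLoop.lean`, i.e. Arora–Barak's
"space can be reused", Thm. 4.2/§4.1). This is the membership half of Thm. 4.13 ("`TQBF` is
`PSPACE`-complete" [SM73]) for the tree's space machines; with the budget `Nu z = quants` the
decider runs the `2^m` leaf evaluations of algorithm `A` (p. 113: the global assignment array)
as `2^m` polynomial-time rounds on one polynomial-size state.

* the state string `St V w (L, done, ans) = ans :: done :: V :: boolPair w (blocks L)`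
  (`w` = the matrix code, `V` = validity bit of the input);
* the round `roundFn ∈ FP`: idle once done; otherwise evaluate the matrix at the assignment of
  the state with the tree's `TAUT` checker (`TautProg.tautFn ⟨w, blocks L⟩ = [¬ φ(assignOf L)]`,
  `certAssignment_blocks`) and run the carry transducer — `roundFn (St V w s) = St V w (mround V _ s)`
  (`roundFn_St`);
* the initial state `initFn ∈ FP`: `validFn z`, the matrix code `sndF z`, and the initial blocks
  `blocks (inner₀ (fstF z) 0)` produced by the indexed fold brick `foldLoop` (prepending the
  block of variable `j` at round `j`, `blocksFn_apply`);
* `tqbfDecider : OrbitDecider TQBF` and `TQBF_mem_PSPACE`.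

## References

* S. Arora, B. Barak, *Computational Complexity: A Modern Approach*, CUP 2009, Thm. 4.13 (proof,
  first half, and p. 113), Thm. 4.2/§4.1 [AroraBarakCC2009].
-/

noncomputable section

namespace Literature.Barriers.QuantumAdvantage

open _root_.Computability Literature.Computability.Complexity Brick Polynomial

namespace TQBFEval

/-! ### The state string and the round function -/

/-- The state string of the model state `s = (blocks, done, answer)` with validity bit `V` and
matrix code `w`: `answer :: done :: V :: boolPair w (blocks s.1)`. [folklore] -/
def St (V : Bool) (w : List Bool) (s : List Blk × Bool × Bool) : List Bool :=
  s.2.2 :: s.2.1 :: V :: boolPair w (blocks s.1)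

/-- Length of a state string. [folklore] -/
theorem length_St (V : Bool) (w : List Bool) (s : List Blk × Bool × Bool) :
    (St V w s).length = 2 * w.length + (blocks s.1).length + 5 := by
  simp [St, length_boolPair]; omega

/-- The head bit of a state string is the answer. [folklore] -/
@[simp] theorem headI_St (V : Bool) (w : List Bool) (s : List Blk × Bool × Bool) : (St V w s).headI = s.2.2 := rfl

/-- Drop the three leading bits: `⟨w, blocks⟩`. [folklore] -/
def tl3 : List Bool → List Bool := List.tail ∘ List.tail ∘ List.tail

/-- The validity bit of a state, as a one-symbol string. [folklore] -/
def vF : List Bool → List Bool := take1Fn ∘ List.tail ∘ List.tail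

/-- **The leaf value**: the matrix at the assignment of the state, `[¬ chkTaut w (blocks L)]`
(the tree's polynomial-time `TAUT` checker reads the state as a certificate table).
[cite: AroraBarakCC2009, Thm. 4.13 (proof: "If n = 0 … the formula … can be evaluated in O(m) time")] -/
def leafFn : List Bool → List Bool := notFn (TautProg.tautFn ∘ tl3)

/-- **One round, running case**: the carry transducer on `V :: leaf :: ⟨w, blocks⟩`.
[cite: AroraBarakCC2009, Thm. 4.13 (proof, p. 113)] -/
def stepFn : List Bool → List Bool := carryT.eval ∘ fun st => vF st ++ (leafFn st ++ tl3 st)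

/-- **One round**: idle if the done bit (second symbol) is set, else `stepFn`. [folklore] -/
def roundFn : List Bool → List Bool := iteFn (take1Fn ∘ List.tail) id stepFn

/-- `tl3 ∈ FP`. [folklore] -/
theorem tl3_mem_FP : tl3 ∈ FP :=
  comp_mem_FP PRelSigma.tail_mem_FP (comp_mem_FP PRelSigma.tail_mem_FP PRelSigma.tail_mem_FP)

/-- `vF ∈ FP`. [folklore] -/
theorem vF_mem_FP : vF ∈ FP :=
  comp_mem_FP take1Fn_mem_FP (comp_mem_FP PRelSigma.tail_mem_FP PRelSigma.tail_mem_FP)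

/-- `leafFn ∈ FP`. [folklore] -/
theorem leafFn_mem_FP : leafFn ∈ FP := notFn_mem_FP (comp_mem_FP TautProg.tautFn_mem_FP tl3_mem_FP)

/-- **`stepFn ∈ FP`** (a finite-state transduction after `FP` plumbing). [cite: AroraBarakCC2009, §1.3] -/
theorem stepFn_mem_FP : stepFn ∈ FP :=
  comp_mem_FP carryT.polyTimeComputable_eval (append_mem_FP vF_mem_FP (append_mem_FP leafFn_mem_FP tl3_mem_FP))

/-- **`roundFn ∈ FP`.** [cite: AroraBarakCC2009, §1.3] -/
theorem roundFn_mem_FP : roundFn ∈ FP :=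
  iteFn_mem_FP (comp_mem_FP take1Fn_mem_FP PRelSigma.tail_mem_FP) OracleCompose.id_mem_FP stepFn_mem_FP

/-- The leaf function of a matrix code `w` on the model: `L ↦ ¬ chkTaut w (blocks L)`. [folklore] -/
def leafOf (w : List Bool) (L : List Blk) : Bool := !chkTaut w (blocks L)

/-- **On the code of a formula the leaf function is the formula at the assignment of the state.**
[folklore] -/
theorem leafOf_encode (φ : PropForm ℕ) : leafOf (encodingPropForm.encode φ) = fun L => φ.eval (assignOf L) := by
  funext L
  rw [leafOf, chkTaut_encode, Bool.not_not]
  congr 1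
  funext n
  exact certAssignment_blocks L n

/-- The leaf value of a state string. [folklore] -/
theorem leafFn_St (V : Bool) (w : List Bool) (s : List Blk × Bool × Bool) : leafFn (St V w s) = [leafOf w s.1] := by
  have h : (TautProg.tautFn ∘ tl3) (St V w s) = [chkTaut w (blocks s.1)] := by
    simp [tl3, St, TautProg.tautFn_boolPair]
  rw [leafFn, notFn_apply h, leafOf]

/-- **The running round on a state string is the model round.** [cite: AroraBarakCC2009, Thm. 4.13 (proof, p. 113)] -/
theorem stepFn_St (V : Bool) (w : List Bool) (L : List Blk) (ans : Bool) :
    stepFn (St V w (L, false, ans)) = St V w (mround V (leafOf w) (L, false, ans)) := by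
  rw [stepFn, Function.comp_apply, leafFn_St]
  have hv : vF (St V w (L, false, ans)) = [V] := rfl
  have ht : tl3 (St V w (L, false, ans)) = boolPair w (blocks L) := rfl
  rw [hv, ht, List.singleton_append, List.singleton_append, carryT_eval_state, mround_running]
  rfl

/-- **The round on a state string is the model round.** [cite: AroraBarakCC2009, Thm. 4.13 (proof, p. 113)] -/
theorem roundFn_St (V : Bool) (w : List Bool) (s : List Blk × Bool × Bool) :
    roundFn (St V w s) = St V w (mround V (leafOf w) s) := by
  obtain ⟨L, d, ans⟩ := s
  cases d
  · rw [roundFn, iteFn_apply_false (show (take1Fn ∘ List.tail) (St V w (L, false, ans)) = [false] from rfl), stepFn_St]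
  · rw [roundFn, iteFn_apply_true (show (take1Fn ∘ List.tail) (St V w (L, true, ans)) = [true] from rfl), id,
      mround_done]

/-- **The orbit of the round function is the orbit of the model.** [folklore] -/
theorem iterate_roundFn_St (V : Bool) (w : List Bool) (k : ℕ) (s : List Blk × Bool × Bool) :
    roundFn^[k] (St V w s) = St V w ((mround V (leafOf w))^[k] s) := by
  induction k generalizing s with
  | zero => rfl
  | succ k ih => rw [Function.iterate_succ_apply, roundFn_St, ih, Function.iterate_succ_apply]

/-! ### The initial blocks -/

/-- Prepending fold operation: `prepF ⟨acc, piece⟩ = piece ++ acc`. [folklore] -/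
def prepF : List Bool → List Bool := fun z => sndF z ++ fstF z

/-- `prepF` on a pair. [folklore] -/
@[simp] theorem prepF_boolPair (a b : List Bool) : prepF (boolPair a b) = b ++ a := by simp [prepF]

/-- `prepF ∈ FP`. [folklore] -/
theorem prepF_mem_FP : prepF ∈ FP := append_mem_FP sndF_mem_FP fstF_mem_FP

/-- Growth of `prepF`: additive. [folklore] -/
theorem length_prepF_le (w : List Bool) : (prepF w).length ≤ (fstF w).length + (sndF w).length + 0 := by
  simp [prepF]; omega

/-- The prepending fold passes its accumulator through at the end. [folklore] -/
theorem foldAcc_prepF_acc (f : List Bool → List Bool) (x : List Bool) : ∀ (k i : ℕ) (acc : List Bool),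
    foldAcc prepF f x i k acc = foldAcc prepF f x i k [] ++ acc
  | 0, i, acc => by simp
  | k + 1, i, acc => by
    rw [foldAcc_succ, foldAcc_succ, foldAcc_prepF_acc f x k (i + 1), foldAcc_prepF_acc f x k (i + 1) (prepF _),
      prepF_boolPair, prepF_boolPair, List.append_nil, List.append_assoc]

/-- The block of variable `j` with quantifier bit `x[j]`, all values `0`, from `⟨x, 1ʲ⟩`:
`⟨bin j, [0]⟩ ++ 0001 0 ++ 0001 x[j]`. [folklore] -/
def pieceF : List Bool → List Bool := fun w =>
  fanoutFn (lenBinF ∘ sndF) (fun _ => [false]) w ++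
    ((fun _ => [false, false, false, true, false, false, false, false, true]) w ++ (bitAtFn ∘ fanoutFn sndF fstF) w)

/-- `pieceF ∈ FP`. [folklore] -/
theorem pieceF_mem_FP : pieceF ∈ FP :=
  append_mem_FP (fanoutFn_mem_FP (comp_mem_FP lenBinF_mem_FP sndF_mem_FP) (const_mem_FP _))
    (append_mem_FP (const_mem_FP _) (comp_mem_FP bitAtFn_mem_FP (fanoutFn_mem_FP sndF_mem_FP fstF_mem_FP)))

/-- **The piece at index `j < |x|` is the initial block of variable `j`.** [folklore] -/
theorem pieceF_apply (x : List Bool) {j : ℕ} (hj : j < x.length) :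
    pieceF (boolPair x (ones j)) = Blk.code ⟨j, false, false, x[j]⟩ := by
  have hlen : (ones j).length = j := List.length_replicate
  simp only [pieceF, Function.comp_apply, fanoutFn_apply, sndF_boolPair, fstF_boolPair, lenBinF_apply, hlen]
  rw [bitAtFn_boolPair_of_lt _ _ (by rw [hlen]; exact hj)]
  simp [Blk.code, entry, boolPair, hlen]

/-- The pieces are short: `|pieceF ⟨x, 1ʲ⟩| ≤ 13 (|x| + 1)` for `j < |x|`. [folklore] -/
theorem length_pieceF_le (x : List Bool) {j : ℕ} (hj : j < x.length) :
    (pieceF (boolPair x (ones j))).length ≤ 13 * (x.length + 1) := by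
  rw [pieceF_apply x hj, Blk.length_code]
  have h : (encodeNat j).length ≤ j := by
    rw [TM2Pass.length_encodeNat_eq_size]
    exact Nat.size_le.2 Nat.lt_two_pow_self
  simp only
  omega

/-- **The prepending fold of the pieces builds the initial blocks**, innermost variable first.
[folklore] -/
theorem foldAcc_prepF_pieceF (x : List Bool) : ∀ (k i : ℕ), i + k = x.length →
    foldAcc prepF pieceF x i k [] = blocks (inner₀ (x.drop i) i)
  | 0, i, h => by
    rw [foldAcc_zero, List.drop_of_length_le (by omega)]
    rfl
  | k + 1, i, h => by
    have hi : i < x.length := by omega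
    rw [foldAcc_succ, foldAcc_prepF_acc, foldAcc_prepF_pieceF x k (i + 1) (by omega), prepF_boolPair,
      List.append_nil, pieceF_apply x hi, List.drop_eq_getElem_cons hi, inner₀, blocks_append]
    simp [blocks]

/-- **The initial blocks as an `FP` function of the prefix**: set up the fold record
`⟨x, ⟨bin |x|, ⟨ε, ε⟩⟩⟩`, run the clipped prepending fold for `|x|` rounds, project the
accumulator. [cite: AroraBarakCC2009, §1.3 (bounded loops)] -/
def blocksFn : List Bool → List Bool :=
  sndPow 2 ∘ foldLoop prepF (clipF 13 pieceF) X ∘ fanoutFn id (fanoutFn lenBinF (fanoutFn (fun _ => []) (fun _ => [])))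

/-- **`blocksFn ∈ FP`.** [cite: AroraBarakCC2009, §1.3 (bounded loops)] -/
theorem blocksFn_mem_FP : blocksFn ∈ FP :=
  comp_mem_FP (sndPow_mem_FP 2)
    (comp_mem_FP (foldLoop_clipF_mem_FP 13 prepF_mem_FP length_prepF_le pieceF_mem_FP X)
      (fanoutFn_mem_FP OracleCompose.id_mem_FP
        (fanoutFn_mem_FP lenBinF_mem_FP (fanoutFn_mem_FP (const_mem_FP _) (const_mem_FP _)))))

/-- **`blocksFn x` is the string of the initial blocks of the prefix `x`.** [folklore] -/
theorem blocksFn_apply (x : List Bool) : blocksFn x = blocks (inner₀ x 0) := by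
  have h := foldLoop_apply prepF (clipF 13 pieceF) (p := X) (x := x) (k := x.length) (by simp) 0 []
  rw [show (ones 0 : List Bool) = [] from rfl, Nat.zero_add] at h
  simp only [blocksFn, Function.comp_apply, fanoutFn_apply, id, lenBinF_apply]
  rw [h, sndPow_succ_boolPair, sndPow_succ_boolPair, sndPow_zero_boolPair,
    foldAcc_clipF (fun j _ hj => length_pieceF_le x (by simpa using hj)),
    foldAcc_prepF_pieceF x x.length 0 (by simp), List.drop_zero]

/-! ### The initial state and the budget -/

/-- **The initial state** of input `z = ⟨quants, w⟩`: answer and done bits `0`, the validity bit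
`validFn z`, the matrix code `w = sndF z`, and the initial blocks of `quants = fstF z`.
[cite: AroraBarakCC2009, Thm. 4.13 (proof, p. 113)] -/
def initFn : List Bool → List Bool :=
  List.cons false ∘ List.cons false ∘ fun z => validFn z ++ fanoutFn sndF (blocksFn ∘ fstF) z

/-- **`initFn ∈ FP`.** [cite: AroraBarakCC2009, §1.3] -/
theorem initFn_mem_FP : initFn ∈ FP :=
  comp_mem_FP (cons_mem_FP false) (comp_mem_FP (cons_mem_FP false)
    (append_mem_FP validFn_mem_FP (fanoutFn_mem_FP sndF_mem_FP (comp_mem_FP blocksFn_mem_FP fstF_mem_FP))))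

/-- The validity bit of an input. [folklore] -/
def vBit (z : List Bool) : Bool := (validFn z).headI

/-- `validFn z = [vBit z]`. [folklore] -/
theorem validFn_eq_vBit (z : List Bool) : validFn z = [vBit z] := by
  obtain ⟨b, hb⟩ := oneBit_validFn z
  rw [vBit, hb]
  rfl

/-- **The initial state is a state string.** [folklore] -/
theorem initFn_apply (z : List Bool) :
    initFn z = St (vBit z) (sndF z) (inner₀ (fstF z) 0, false, false) := by
  simp only [initFn, Function.comp_apply, fanoutFn_apply, blocksFn_apply, validFn_eq_vBit]
  rfl

/-- **The orbit from the initial state.** [folklore] -/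
theorem iterate_roundFn_initFn (z : List Bool) (k : ℕ) :
    roundFn^[k] (initFn z) =
      St (vBit z) (sndF z) ((mround (vBit z) (leafOf (sndF z)))^[k] (inner₀ (fstF z) 0, false, false)) := by
  rw [initFn_apply, iterate_roundFn_St]

/-- With validity bit `0` the answer bit stays `0`. [folklore] -/
theorem ans_iterate_mround_false (g : List Blk → Bool) (k : ℕ) (L : List Blk) :
    ((mround false g)^[k] (L, false, false)).2.2 = false := by
  suffices h : ∀ s : List Blk × Bool × Bool, s.2.2 = false → ((mround false g)^[k] s).2.2 = false from
    h _ rfl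
  induction k with
  | zero => exact fun s hs => hs
  | succ k ih =>
    intro s hs
    rw [Function.iterate_succ_apply]
    refine ih _ ?_
    unfold mround
    split
    · exact hs
    · simp

/-- The size of a numeral is at most its value. [folklore] -/
theorem length_encodeNat_le (n : ℕ) : (encodeNat n).length ≤ n := by
  rw [TM2Pass.length_encodeNat_eq_size]
  exact Nat.size_le.2 Nat.lt_two_pow_self

/-- **The orbit is polynomially short**: `|roundFn^[k] (initFn z)| ≤ 2|z|² + 15|z| + 5`. [folklore] -/
theorem length_iterate_roundFn_initFn_le (z : List Bool) (k : ℕ) :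
    (roundFn^[k] (initFn z)).length ≤ 2 * z.length ^ 2 + 15 * z.length + 5 := by
  rw [iterate_roundFn_initFn, length_St]
  have hparts := length_fstF_sndF_le z
  have hidx := map_idx_iterate_mround (vBit z) (leafOf (sndF z)) k (inner₀ (fstF z) 0, false, false)
  rw [length_blocks_eq_of_map_idx_eq hidx]
  have hb : (blocks (inner₀ (fstF z) 0)).length ≤ (fstF z).length * (2 * (encodeNat (fstF z).length).length + 13) := by
    have h := length_blocks_le (L := inner₀ (fstF z) 0) (m := (fstF z).length)
      (fun B hB => by have := idx_mem_inner₀ hB; omega)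
    rwa [length_inner₀] at h
  have he := length_encodeNat_le (fstF z).length
  have hm : (fstF z).length * (2 * (encodeNat (fstF z).length).length + 13) ≤ z.length * (2 * z.length + 13) :=
    Nat.mul_le_mul (by omega) (by omega)
  nlinarith

/-- **The orbit decider of `TQBF`** (Arora–Barak's algorithm `A` as `2^m` polynomial-time rounds
on one polynomial-size state): round `roundFn`, initial state `initFn`, unary budget
`fstF z = quants` (so `2^m` rounds, `m` = number of quantifiers), size polynomial
`2X² + 15X + 5`. [cite: AroraBarakCC2009, Thm. 4.13 (proof, first half, and p. 113)] -/
def tqbfDecider : OrbitDecider TQBF where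
  F := roundFn
  F_mem := roundFn_mem_FP
  ι := initFn
  ι_mem := initFn_mem_FP
  Nu := fstF
  Nu_mem := fstF_mem_FP
  s := 2 * X ^ 2 + 15 * X + 5
  Nu_le z := by
    have := length_fstF_sndF_le z
    simp only [eval_add, eval_mul, eval_ofNat, eval_pow, eval_X]
    nlinarith
  size_le z k := by
    have := length_iterate_roundFn_initFn_le z k
    simp only [eval_add, eval_mul, eval_ofNat, eval_pow, eval_X]
    exact this
  correct z := by
    rw [iterate_roundFn_initFn, headI_St]
    constructor
    · intro h
      -- the validity bit is set
      have hV : vBit z = true := by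
        by_contra hV
        rw [Bool.not_eq_true] at hV
        rw [hV, ans_iterate_mround_false] at h
        exact Bool.false_ne_true h
      obtain ⟨ψ, rfl, hc⟩ := exists_of_validFn_eq_true (by rw [validFn_eq_vBit, hV])
      have hz : ψ.encode = boolPair ψ.quants (encodingPropForm.encode ψ.matrix) := rfl
      rw [hV, hz, fstF_boolPair, sndF_boolPair, leafOf_encode, iterate_mround_final] at h
      exact (encode_mem_TQBF_iff ψ).2 ⟨hc, by change qbfEval _ _ 0 _ = true; simpa using h⟩
    · rintro ⟨ψ, rfl, hc, ht⟩
      have hV : vBit ψ.encode = true := by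
        have h1 := validFn_eq_vBit ψ.encode
        rw [validFn_encode, decide_eq_true hc] at h1
        exact (List.cons.inj h1).1.symm
      have hz : ψ.encode = boolPair ψ.quants (encodingPropForm.encode ψ.matrix) := rfl
      rw [hV, hz, fstF_boolPair, sndF_boolPair, leafOf_encode, iterate_mround_final]
      change (qbfEval ψ.matrix ψ.quants 0 (fun _ => false) && true) = true
      rw [Bool.and_true]
      exact ht

end TQBFEval

/-- **`TQBF ∈ PSPACE`** (Arora–Barak 2009, Thm. 4.13, first half; Stockmeyer–Meyer 1973), for the
tree's `TQBF` and the tree's `PSPACE` of input-preserving space machines: the orbit decider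
`TQBFEval.tqbfDecider` run by the loop space machine (`OrbitDecider.mem_PSPACE`).
[cite: AroraBarakCC2009, Thm. 4.13] -/
theorem TQBF_mem_PSPACE : TQBF ∈ PSPACE :=
  TQBFEval.tqbfDecider.mem_PSPACE

end Literature.Barriers.QuantumAdvantage
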